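import Mathlib
import Summits.CriticalPhenomena.PercolationContinuityZ3.Theorems.PercNearOneGluingNoHeavyLowerTailOrderedDifferences

/-!
# Ordered Marica–Schönheim: the injective (SDR) form, and Marica–Schönheim / the rank conjecture as corollaries

Helper file for crux `stmt-CriticalPhenomena-4575` (`NoHeavyLowerTail`, route `PercNearOneGluingNoHeavy`),
new-inequality factory seat `prim-ineq-gen-3` (gen 5).  Pure finite set theory; everything here is PROVED.

`OrderedDifferences.card_le_card_of_rank` (this seat, gen 5) says: if `A : ι → Finset α` carries a rank function `r`
into a linear order with `A i ⊄ A j` for `i ≠ j`, `r i ≤ r j`, and `T` contains every difference `A i \ A j` with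
`r i ≤ r j`, then `card ι ≤ #T`.  Since the hypotheses are inherited by every sub-family, Hall's marriage theorem turns
the count into a **system of distinct representatives** (`exists_injective_mem_subset_of_rank`): an injective
`f : ι → Finset α` with `f i ∈ T` and `f i ⊆ A i` — 'Hall via ordered differences', the form in which the tool is used
to build injections.  Specialisations: the `Fin m` form (`exists_injective_mem_subset`), and for a single family listed
by non-increasing size an injective Marica–Schönheim map `𝒜 → 𝒜 \\ 𝒜`, `A ↦ f A ⊆ A` (`exists_injective_mem_diffs_subset`;
the counting statement `#𝒜 ≤ #(𝒜 \\ 𝒜)` is Mathlib's `Finset.card_le_card_diffs`, and an explicit such injection by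
minimum-gap batches is gen 4's `TwoFamilyDifferences.exists_injOn_diffs`).
(prim-ineq-gen-3 gen 5, 2026-08-20; memo `run/shared/lean/prim/prim-ineq-gen-3/COMB.md` §3c (xviii).)
-/

namespace Summit.CriticalPhenomena.PercolationContinuityZ3.Theorems

namespace OrderedDifferences

open Finset
open scoped FinsetFamily

variable {α : Type*} [DecidableEq α]

/-- **Hall via ordered differences (SDR form of the block ordered Marica–Schönheim inequality).**  Under the
hypotheses of `card_le_card_of_rank` there is an injective choice `f i ∈ T` with `f i ⊆ A i`. -/
theorem exists_injective_mem_subset_of_rank {ι β : Type*} [Fintype ι] [DecidableEq ι] [LinearOrder β]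
    (A : ι → Finset α) (r : ι → β) (hA : ∀ ⦃i j : ι⦄, i ≠ j → r i ≤ r j → ¬ A i ⊆ A j)
    (T : Finset (Finset α)) (hT : ∀ ⦃i j : ι⦄, r i ≤ r j → A i \ A j ∈ T) :
    ∃ f : ι → Finset α, Function.Injective f ∧ ∀ i, f i ∈ T ∧ f i ⊆ A i := by
  classical
  let t : ι → Finset (Finset α) := fun i => T.filter (· ⊆ A i)
  have hHall : ∀ s : Finset ι, #s ≤ #(s.biUnion t) := by
    intro s
    -- apply the counting theorem to the sub-family indexed by `s`, with target family `s.biUnion t`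
    have h := card_le_card_of_rank (ι := ↥s) (fun i => A i) (fun i => r i)
      (fun i j hij hr => hA (fun h => hij (Subtype.ext h)) hr) (s.biUnion t) ?_
    · rwa [Fintype.card_coe] at h
    · rintro ⟨i, hi⟩ ⟨j, hj⟩ hr
      rw [mem_biUnion]
      exact ⟨i, hi, mem_filter.mpr ⟨hT hr, sdiff_subset⟩⟩
  obtain ⟨f, hfinj, hf⟩ := (all_card_le_biUnion_card_iff_exists_injective t).mp hHall
  refine ⟨f, hfinj, fun i => ?_⟩
  have hi := hf i
  simp only [t, mem_filter] at hi
  exact hi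

/-- **Injective ordered Marica–Schönheim.**  If `A₀, …, A_{m-1}` are finite sets with `Aᵢ ⊄ Aⱼ` for `i < j` and
`T` contains all `Aᵢ \ Aⱼ` (`i ≤ j`), then there is an injective `f : Fin m → Finset α` with `f i ∈ T`, `f i ⊆ Aᵢ`. -/
theorem exists_injective_mem_subset {m : ℕ} (A : Fin m → Finset α)
    (hA : ∀ ⦃i j : Fin m⦄, i < j → ¬ A i ⊆ A j) (T : Finset (Finset α))
    (hT : ∀ ⦃i j : Fin m⦄, i ≤ j → A i \ A j ∈ T) :
    ∃ f : Fin m → Finset α, Function.Injective f ∧ ∀ i, f i ∈ T ∧ f i ⊆ A i :=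
  exists_injective_mem_subset_of_rank A id (fun _ _ hij hle => hA (lt_of_le_of_ne hle hij)) T hT

/-- **Injective Marica–Schönheim.**  Every finite family `𝒜` of finite sets admits an injective map into its
difference family `𝒜 \\ 𝒜` along inclusion: `f A ∈ 𝒜 \\ 𝒜`, `f A ⊆ A` (rank = minus the cardinality). -/
theorem exists_injective_mem_diffs_subset (𝒜 : Finset (Finset α)) :
    ∃ f : ↥𝒜 → Finset α, Function.Injective f ∧ ∀ A : ↥𝒜, f A ∈ 𝒜 \\ 𝒜 ∧ f A ⊆ (A : Finset α) := by
  classical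
  refine exists_injective_mem_subset_of_rank (ι := ↥𝒜) (fun A => (A : Finset α))
    (fun A => OrderDual.toDual #(A : Finset α)) ?_ (𝒜 \\ 𝒜) ?_
  · rintro ⟨X, hX⟩ ⟨Y, hY⟩ hne hr hXY
    have hle : #Y ≤ #X := hr
    exact hne (Subtype.ext (eq_of_subset_of_card_le hXY hle))
  · rintro ⟨X, hX⟩ ⟨Y, hY⟩ -
    exact mem_diffs.mpr ⟨X, hX, Y, hY, rfl⟩

/-- **Rank conjecture R (gen 4), counting shadow.**  Under the no-containment hypothesis of `MS2′`, the members of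
`𝒞 ∪ ℬ` have distinct representatives `f X ⊆ X` inside `(𝒞 \\ 𝒞) ∪ (𝒞 \\ ℬ) ∪ (ℬ \\ ℬ)`. -/
theorem exists_injective_mem_diffs_union_subset (𝒞 ℬ : Finset (Finset α))
    (h : ∀ C ∈ 𝒞, ∀ B ∈ ℬ, ¬ C ⊆ B) :
    ∃ f : ↥(𝒞 ∪ ℬ) → Finset α, Function.Injective f ∧
      ∀ X : ↥(𝒞 ∪ ℬ), f X ∈ (𝒞 \\ 𝒞) ∪ (𝒞 \\ ℬ) ∪ (ℬ \\ ℬ) ∧ f X ⊆ (X : Finset α) := by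
  classical
  have hdisj : Disjoint 𝒞 ℬ := by
    rw [Finset.disjoint_left]
    intro X hXC hXB
    exact h X hXC X hXB subset_rfl
  set K : ℕ := (𝒞 ∪ ℬ).sup card + 1 with hK
  have hcardK : ∀ X ∈ 𝒞 ∪ ℬ, #X < K := by
    intro X hX
    have := Finset.le_sup (f := card) hX
    omega
  refine exists_injective_mem_subset_of_rank (ι := ↥(𝒞 ∪ ℬ)) (fun X => (X : Finset α))
    (fun X => (if (X : Finset α) ∈ ℬ then (K : ℤ) else 0) - (#(X : Finset α) : ℤ)) ?_
    ((𝒞 \\ 𝒞) ∪ (𝒞 \\ ℬ) ∪ (ℬ \\ ℬ)) ?_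
  · rintro ⟨X, hX⟩ ⟨Y, hY⟩ hne hr hXY
    simp only [ne_eq, Subtype.mk.injEq] at hne
    simp only at hr
    have hXK := hcardK X hX
    have hYK := hcardK Y hY
    rcases mem_union.mp hX with hXC | hXB <;> rcases mem_union.mp hY with hYC | hYB
    · rw [if_neg (Finset.disjoint_left.mp hdisj hXC), if_neg (Finset.disjoint_left.mp hdisj hYC)] at hr
      have hle : #Y ≤ #X := by omega
      exact hne (eq_of_subset_of_card_le hXY hle)
    · exact h X hXC Y hYB hXY
    · rw [if_pos hXB, if_neg (Finset.disjoint_left.mp hdisj hYC)] at hr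
      omega
    · rw [if_pos hXB, if_pos hYB] at hr
      have hle : #Y ≤ #X := by omega
      exact hne (eq_of_subset_of_card_le hXY hle)
  · rintro ⟨X, hX⟩ ⟨Y, hY⟩ hr
    simp only at hr
    have hXK := hcardK X hX
    have hYK := hcardK Y hY
    simp only [mem_union, mem_diffs]
    rcases mem_union.mp hX with hXC | hXB <;> rcases mem_union.mp hY with hYC | hYB
    · exact Or.inl (Or.inl ⟨X, hXC, Y, hYC, rfl⟩)
    · exact Or.inl (Or.inr ⟨X, hXC, Y, hYB, rfl⟩)
    · rw [if_pos hXB, if_neg (Finset.disjoint_left.mp hdisj hYC)] at hr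
      omega
    · exact Or.inr ⟨X, hXB, Y, hYB, rfl⟩

end OrderedDifferences

end Summit.CriticalPhenomena.PercolationContinuityZ3.Theorems
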